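/-
Copyright: statement-level skeleton of a published paper (lit-balaban cell, Phase-2 proof seat p25, gen 19). No proof
claims beyond what the kernel checks below.
-/
import Literature.MathematicalPhysics.QuantumFieldTheory.BalabanImbrieJaffe1984to88.BIJ88WalkIneq312RemainderBdry

/-!
# `BalabanImbrieJaffe1984to88.BIJ88WalkIneq312NonVacuity` — T. Bałaban, J. Imbrie, A. Jaffe, *Effective action and
cluster properties of the abelian Higgs model*, Commun. Math. Phys. **114** (1988) 257–315 [BalabanImbrieJaffe1988],
§5.14 p. 312 [PDF 56] — **KERNEL NON-VACUITY CERTIFICATE FOR `ineq312_remainder` / `ineq312_remainder_bdry`**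
(p25 gen 19; the referee's usual condition, R-g51-1 precedent; owner r16 v2.278/v2.281; v1.1 docfix: the two toy theorems'
tags name the unnumbered estimate preceding (5.14.5), as the head's; v1.2 APPEND-ONLY §3: a less degenerate toy —
genuine observable, true covariance as the local piece, the moment letter instantiated; §1–§2 untouched): every binder of
`BIJ88WalkIneq312RemainderBdry.ineq312_remainder_bdry` (hence of `BIJ88WalkIneq312Remainder.ineq312_remainder`) is
inhabited on a TOY instance and every hypothesis is discharged by the kernel — one lattice site (`α = I = Unit`,
`W = {()}`, `Δ = 1`, `ℱ = 0`, so `prec = 1 ≻ 0` and the §5.13 law is the standard Gaussian), one observable with one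
(zero) leg (`κ = Unit`, `obs () = [0]`), no vertices (`ι = Fin 0`), one covariance piece `Cov () = 0` (local,
`trig = false`), the constant cutoff `χ ≡ 1`, directions `Dir = {0}`, currency `B_ℓ = θ = θ_v = θ_w = η_χ = 1`,
`ρ₀ = N₀ = 0`, `K_χ = Λ = 1`, `M = 1`, no boundary observables (`bdry = ∅`).  The expectation hypothesis `hE` is
discharged for EVERY term of the expansion without unfolding it: pending legs stay in `Dir = {0}` (`expand_pend_dir`,
from gen 18's `run_pend_dir`), so the leg monomial is the constant `1` or `0`, and a `χ′`-direction kills the term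
(`(Π_{z::D}∂)1 = 0`).  The certificate says nothing about print beyond consistency of the hypotheses.

statement-level skeleton of published theorems with citation tags; proofs where landed; nothing here is a claim
about the Yang–Mills mass gap

CITATION HEADER (lean-in-tree rule).  lit-balaban cell (HOME `run/shared/lean/pub/lit-balaban/`), Phase 2, seat p25
gen 19; row **C2.Claim@312** of `HOME/lit-balaban-r16/ROWS-C2-part2.md` (owner r16, referee ref-5) — support file for
the head question (non-vacuity of the inhabited leaf).  USED BY NAME: `BIJ88WalkIneq312RemainderBdry.ineq312_remainder_bdry`,
`BIJ88WalkIneq312Remainder.ineq312_remainder`, `BIJ88WalkWeights312.run_pend_dir`, `BIJ88WalkRunEnv311.{run_done_le,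
run_rest_subset}`, `BIJ88DirichletForms305.interpForm_posDef`, `BIJ88SlotMomentsGauss308.isProbabilityMeasure_fieldLaw`,
`BIJ88WickDerivatives305.{dlist, dlist_zero}`, `BIJ88VertexIbp311.{vexp, vpoly}`.

## What is proved (0 `sorry`, standard axioms, no new `Prop` facts; theorems only)

* §1 `expand_pend_dir` (pending legs of blocks and remainder components stay in `Dir`), `dlist_cons_const`.
* §2 the toy: `toy_prec_posDef`, `toy_hE`, **`ineq312_remainder_toy`**, **`ineq312_remainder_bdry_toy`**.
* §3 (v1.2, append-only) a LESS DEGENERATE toy: the genuine one-site observable `Φ(e) = φ(site)` (leg `e = 1 ≠ 0`), the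
  TRUE covariance as the single local piece (`Cov () = 1 = prec⁻¹`), `Dir = {e}`, `B_ℓ = #sites`, `bdry =` everything,
  and the moment letter `Λ_O` INSTANTIATED as the sum of the absolute expectations over the (finite) expansion:
  `toy2_hE`, **`ineq312_remainder_bdry_toy2`** (owner r16 v2.281/v2.289: "less-degenerate toy optional").
HONEST SCOPE: a consistency certificate on a degenerate one-site instance; nothing of print is modelled by the toy.
NOT summit progress; NOT continuum; NOT Clay.  Imports `BIJ88WalkIneq312RemainderBdry`; modifies nothing.
-/

noncomputable section

namespace Literature.MathematicalPhysics.QuantumFieldTheory.BalabanImbrieJaffe1984to88.BIJ88WalkIneq312NonVacuity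

open Classical MeasureTheory Matrix Finset
open scoped BigOperators
open Literature.MathematicalPhysics.QuantumFieldTheory.Balaban1983to89
open B2Eq228Conditioning (weight source)
open BIJ88PolymerRep5134 (corner corner_apply)
open BIJ88PolymerRep5134Gauss (prec src)
open BIJ88DirichletForms305 (interpForm_posDef)
open BIJ88SlotMomentsGauss308 (fieldLaw isProbabilityMeasure_fieldLaw)
open BIJ88VertexIbp311 (vexp vpoly)
open BIJ88WickDerivatives305 (dlist dlist_nil dlist_cons dlist_zero)
open BIJ88VertexComponents311 (maxArity)
open BIJ88LabelledRun311 (mem_mbind)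
open BIJ88WalkRun311 BIJ88WalkRunEnv311 BIJ88WalkExpansion311 BIJ88WalkWeights312 BIJ88WalkRemainderActivity312
  BIJ88WalkIneq312Remainder BIJ88WalkIneq312RemainderBdry

/-! ## §1  Two bookkeeping lemmas -/

section Support

variable {S : Type} [Fintype S] {ι : Type} [Fintype ι] {κ : Type} [LinearOrder κ] {P : Type} [Fintype P]
variable {Cov : P → Matrix S S ℝ} {trig : P → Bool} {f : S → ℝ} {c : ι → ℝ} {legs : ι → List (S → ℝ)}
  {obs : κ → List (S → ℝ)} {M : ℕ}

/-- **Pending legs stay in `Dir`**: if the legs of every observable and of every vertex lie in `Dir`, so do the pending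
legs of every block and of every set-aside component of every term of `expand` (from an environment whose set-aside
components have pending legs in `Dir`). [cite: BalabanImbrieJaffe1988, §5.14 p.311] -/
theorem expand_pend_dir {Dir : Set (S → ℝ)} (hobs : ∀ j, ∀ w ∈ obs j, w ∈ Dir) (hlegs : ∀ m, ∀ w ∈ legs m, w ∈ Dir) :
    ∀ (n : ℕ) (done : Multiset (WGrp S κ ι P)) (rest : Finset κ), rest.card < n →
      (∀ h ∈ done, ∀ w ∈ h.pend, w ∈ Dir) → ∀ t ∈ expand Cov trig f c legs obs M done rest,
        ∀ X ∈ t.consts + t.groups, ∀ w ∈ X.pend, w ∈ Dir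
  | 0, _, _, hn => fun _ _ _ => absurd hn (Nat.not_lt_zero _)
  | n + 1, done, rest, hn => by
    intro hd t ht
    by_cases h : rest.Nonempty
    · rw [expand_of_nonempty Cov trig f c legs obs M h, mem_mbind] at ht
      obtain ⟨o, ho, ht⟩ := ht
      have hcard : o.rest.card < n := lt_of_lt_of_le (lt_of_le_of_lt (Finset.card_le_card (run_rest_subset _ _ _ o ho))
        (Finset.card_erase_lt_of_mem (rest.min'_mem h))) (Nat.lt_succ_iff.1 hn)
      have hdo : ∀ h ∈ o.done, ∀ w ∈ h.pend, w ∈ Dir :=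
        fun h hh => hd h (Multiset.mem_of_le (run_done_le _ _ _ o ho) hh)
      have hg : ∀ w ∈ o.g.pend, w ∈ Dir :=
        run_pend_dir (Cov := Cov) (trig := trig) (f := f) (c := c) (M := M) hobs hlegs _ _ _ o ho
          (by simpa [pristine] using hobs (rest.min' h)) hd
      split_ifs at ht with hc
      · rw [Multiset.mem_map] at ht
        obtain ⟨t', ht', rfl⟩ := ht
        have IH := expand_pend_dir hobs hlegs n o.done o.rest hcard hdo t' ht'
        intro X hX
        simp only [WTerm.addConst_consts, WTerm.addConst_groups, oact_consts, oact_groups, Multiset.cons_add,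
          Multiset.mem_cons] at hX
        rcases hX with rfl | hX
        · exact hg
        · exact IH X hX
      · rw [Multiset.mem_map] at ht
        obtain ⟨t', ht', rfl⟩ := ht
        have hdo' : ∀ h ∈ o.g ::ₘ o.done, ∀ w ∈ h.pend, w ∈ Dir := fun h hh => by
          rcases Multiset.mem_cons.1 hh with rfl | hh
          · exact hg
          · exact hdo h hh
        have IH := expand_pend_dir hobs hlegs n _ o.rest hcard hdo' t' ht'
        simpa only [oact_consts, oact_groups] using IH
    · rw [expand_of_not_nonempty Cov trig f c legs obs M h, Multiset.mem_singleton] at ht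
      subst ht
      intro X hX
      rw [zero_add] at hX
      exact hd X hX

omit [Fintype S] in
/-- A directional derivative kills a constant: `(Π_{u::L}∂)(a) = 0`. [folklore] [cite: BalabanImbrieJaffe1988, §5.14 p.312] -/
theorem dlist_cons_const (u : S → ℝ) (L : List (S → ℝ)) (a : ℝ) : dlist (u :: L) (fun _ => a) = 0 := by
  rw [dlist_cons]
  have e : (fun φ : S → ℝ => fderiv ℝ (fun _ : S → ℝ => a) φ u) = 0 := by funext φ; simp
  rw [e, dlist_zero]

end Support

/-! ## §2  The toy instance -/

section Toy

/-- The toy precision `1` at the corner is positive definite. [cite: BalabanImbrieJaffe1988, §5.13 p.305] -/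
theorem toy_prec_posDef : (prec (fun _ : Unit => ()) (1 : Matrix Unit Unit ℝ) ({()} : Finset Unit) (corner ℝ ({()} : Finset Unit))).PosDef :=
  (interpForm_posDef (fun _ : Unit => ()) Matrix.PosDef.one (s := corner ℝ ({()} : Finset Unit)) fun i => by
    rw [corner_apply]; split_ifs <;> norm_num).submatrix Subtype.val_injective

/-- **The expectation hypothesis on the toy**: with the zero leg, no vertex, `Cov = 0` and `χ ≡ 1`, every term of the
expansion has `|𝔼[Π legs · (Π_{dirs}∂)χ · e^{−V}]| ≤ 1·Π_{z∈dirs}(1·‖z‖)·1`. [cite: BalabanImbrieJaffe1988, §5.14 p.312] -/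
theorem toy_hE (Cov : Unit → Matrix {x : Unit // (fun _ : Unit => ()) x ∈ ({()} : Finset Unit)} {x : Unit // (fun _ : Unit => ()) x ∈ ({()} : Finset Unit)} ℝ) (trig : Unit → Bool) (M : ℕ) :
    ∀ O : Finset Unit, ∀ t ∈ expand Cov trig (src (fun _ : Unit => ()) (0 : Unit → ℝ) ({()} : Finset Unit)) (fun _ : Fin 0 => (0 : ℝ))
        (fun _ : Fin 0 => ([] : List ({x : Unit // (fun _ : Unit => ()) x ∈ ({()} : Finset Unit)} → ℝ)))
        (fun _ : Unit => [(0 : {x : Unit // (fun _ : Unit => ()) x ∈ ({()} : Finset Unit)} → ℝ)]) M 0 O, t.consts = 0 →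
      |∫ φ, ((t.groups.map fun h => (h.pend : Multiset _)).sum.map fun w => φ ⬝ᵥ w).prod
          * (dlist t.dirs (fun _ => (1 : ℝ)) φ * vexp (fun _ : Fin 0 => (0 : ℝ)) (fun _ : Fin 0 => []) φ)
          ∂(fieldLaw (fun _ : Unit => ()) (1 : Matrix Unit Unit ℝ) (0 : Unit → ℝ) ({()} : Finset Unit))|
        ≤ 1 * (t.dirs.map fun z => (1 : ℝ) * ‖z‖).prod * 1 := by
  intro O t ht _
  haveI := isProbabilityMeasure_fieldLaw (fun _ : Unit => ()) (1 : Matrix Unit Unit ℝ) (0 : Unit → ℝ) ({()} : Finset Unit) toy_prec_posDef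
  have hv : ∀ φ : {x : Unit // (fun _ : Unit => ()) x ∈ ({()} : Finset Unit)} → ℝ, vexp (fun _ : Fin 0 => (0 : ℝ)) (fun _ : Fin 0 => []) φ = 1 := fun φ => by
    simp [vexp, vpoly]
  have hR : 0 ≤ 1 * (t.dirs.map fun z : {x : Unit // (fun _ : Unit => ()) x ∈ ({()} : Finset Unit)} → ℝ => (1 : ℝ) * ‖z‖).prod * 1 :=
    mul_nonneg (mul_nonneg zero_le_one (List.prod_nonneg fun x hx => by
      obtain ⟨z, -, rfl⟩ := List.mem_map.1 hx; exact mul_nonneg zero_le_one (norm_nonneg z))) zero_le_one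
  -- the pending legs are all the zero leg
  have hdir := expand_pend_dir (Cov := Cov) (trig := trig) (f := src (fun _ : Unit => ()) (0 : Unit → ℝ) ({()} : Finset Unit))
    (c := fun _ : Fin 0 => (0 : ℝ)) (legs := fun _ : Fin 0 => ([] : List ({x : Unit // (fun _ : Unit => ()) x ∈ ({()} : Finset Unit)} → ℝ)))
    (obs := fun _ : Unit => [(0 : {x : Unit // (fun _ : Unit => ()) x ∈ ({()} : Finset Unit)} → ℝ)]) (M := M) (Dir := {0})
    (fun _ w hw => by simpa using hw) (fun m => m.elim0) _ 0 O (Nat.lt_succ_self _)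
    (fun _ hh => absurd hh (Multiset.notMem_zero _)) t ht
  rcases hD : t.dirs with _ | ⟨z, D⟩
  · -- no `χ′`-direction: the integrand is the constant leg monomial
    simp only [dlist_nil, hv, mul_one, List.map_nil, List.prod_nil]
    set Legs := (t.groups.map fun h => (h.pend : Multiset ({x : Unit // (fun _ : Unit => ()) x ∈ ({()} : Finset Unit)} → ℝ))).sum with hLegs
    by_cases hM : Legs = 0
    · simp [hM]
    · obtain ⟨w, hw⟩ := Multiset.exists_mem_of_ne_zero hM
      have hw0 : w = 0 := by
        obtain ⟨m, hm, hwm⟩ := Multiset.mem_join.1 hw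
        obtain ⟨X, hX, rfl⟩ := Multiset.mem_map.1 hm
        exact hdir X (Multiset.mem_add.2 (Or.inr hX)) w (Multiset.mem_coe.1 hwm)
      have hP : ∀ φ : {x : Unit // (fun _ : Unit => ()) x ∈ ({()} : Finset Unit)} → ℝ, (Legs.map fun w => φ ⬝ᵥ w).prod = 0 := fun φ =>
        Multiset.prod_eq_zero (Multiset.mem_map.2 ⟨w, hw, by rw [hw0, dotProduct_zero]⟩)
      simp [hP]
  · -- a `χ′`-direction differentiates the constant cutoff away
    simp only [dlist_cons_const, Pi.zero_apply, zero_mul, mul_zero, integral_zero, abs_zero]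
    exact hD ▸ hR

/-- **NON-VACUITY OF `ineq312_remainder_bdry`**: the leaf `Ineq312` for the located remainder families with the
boundary-restricted product, ALL HYPOTHESES DISCHARGED on the toy instance (one site, one zero-leg observable, no
vertex, `Cov = 0`, `χ ≡ 1`, unit currency, `bdry = ∅`). [cite: BalabanImbrieJaffe1988, §5.14 p.312 (estimate preceding (5.14.5))] -/
theorem ineq312_remainder_bdry_toy :
    BIJ88Sect5StatementsPart4.Ineq312 (remSys Unit Unit)
      (fun OX => remAt (prec (fun _ : Unit => ()) (1 : Matrix Unit Unit ℝ) ({()} : Finset Unit) (corner ℝ ({()} : Finset Unit))) (fun _ : Unit => 0) (fun _ : Unit => false)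
          (src (fun _ : Unit => ()) (0 : Unit → ℝ) ({()} : Finset Unit)) (fun _ : Fin 0 => (0 : ℝ)) (fun _ : Fin 0 => []) (fun _ : Unit => [0]) 1
          (fun _ => (1 : ℝ)) (fun _ : Unit => (∅ : Finset Unit)) (fun _ : Fin 0 => (∅ : Finset Unit))
          (fun _ : Unit => (∅ : Finset Unit)) [] 0 OX.1 OX.2
        / ∫ φ, weight (prec (fun _ : Unit => ()) (1 : Matrix Unit Unit ℝ) ({()} : Finset Unit) (corner ℝ ({()} : Finset Unit))) φ * source (src (fun _ : Unit => ()) (0 : Unit → ℝ) ({()} : Finset Unit)) φ)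
      (fun OX => (1 : ℝ) * (fun _ : Finset Unit => (1 : ℝ)) OX.1
        * (max 1 ((0 : ℝ) * ((phi0 (fun _ : Fin 0 => ([] : List ({x : Unit // (fun _ : Unit => ()) x ∈ ({()} : Finset Unit)} → ℝ)))
            (fun _ : Unit => [(0 : {x : Unit // (fun _ : Unit => ()) x ∈ ({()} : Finset Unit)} → ℝ)]) 1 OX.1 + 0 : ℕ) : ℝ)))
          ^ phi0 (fun _ : Fin 0 => ([] : List ({x : Unit // (fun _ : Unit => ()) x ∈ ({()} : Finset Unit)} → ℝ)))
            (fun _ : Unit => [(0 : {x : Unit // (fun _ : Unit => ()) x ∈ ({()} : Finset Unit)} → ℝ)]) 1 OX.1)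
      (fun OX => ∏ _j ∈ OX.1.filter (fun j => j ∈ (∅ : Finset Unit)), (1 : ℝ) ^ ([(0 : {x : Unit // (fun _ : Unit => ()) x ∈ ({()} : Finset Unit)} → ℝ)]).length)
      (fun OX => nfreeOf (fun _ : Unit => (∅ : Finset Unit)) OX.2) 1 1 :=
  ineq312_remainder_bdry (β := Unit) toy_prec_posDef (Dir := {0}) (B' := fun _ => 0) (ρ := fun _ => 0) (cV := fun _ => 0)
    one_pos le_rfl le_rfl (fun _ => le_rfl) (fun _ => le_rfl) (fun m => m.elim0) zero_le_one le_rfl one_pos le_rfl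
    one_pos le_rfl
    (fun _ u _ w _ => by simp) (fun _ u _ => by simp) (fun _ u _ => by simp)
    (fun m => m.elim0) (fun _ w hw => by simpa using hw) (fun m => m.elim0)
    (fun _ _ => ⟨zero_le_one, rfl⟩) (fun _ h => by simp at h) (fun m => m.elim0) le_rfl
    (fun u _ => by simp) (fun _ u _ => by simp) zero_le_one (fun _ => zero_le_one)
    (toy_hE (fun _ => 0) (fun _ => false) 1) ∅
    (fun O t _ _ X _ => by simp)

/-- **NON-VACUITY OF `ineq312_remainder`** (the all-observables product), same toy.
[cite: BalabanImbrieJaffe1988, §5.14 p.312 (estimate preceding (5.14.5))] -/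
theorem ineq312_remainder_toy :
    BIJ88Sect5StatementsPart4.Ineq312 (remSys Unit Unit)
      (fun OX => remAt (prec (fun _ : Unit => ()) (1 : Matrix Unit Unit ℝ) ({()} : Finset Unit) (corner ℝ ({()} : Finset Unit))) (fun _ : Unit => 0) (fun _ : Unit => false)
          (src (fun _ : Unit => ()) (0 : Unit → ℝ) ({()} : Finset Unit)) (fun _ : Fin 0 => (0 : ℝ)) (fun _ : Fin 0 => []) (fun _ : Unit => [0]) 1
          (fun _ => (1 : ℝ)) (fun _ : Unit => (∅ : Finset Unit)) (fun _ : Fin 0 => (∅ : Finset Unit))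
          (fun _ : Unit => (∅ : Finset Unit)) [] 0 OX.1 OX.2
        / ∫ φ, weight (prec (fun _ : Unit => ()) (1 : Matrix Unit Unit ℝ) ({()} : Finset Unit) (corner ℝ ({()} : Finset Unit))) φ * source (src (fun _ : Unit => ()) (0 : Unit → ℝ) ({()} : Finset Unit)) φ)
      (fun OX => (1 : ℝ) * (fun _ : Finset Unit => (1 : ℝ)) OX.1
        * (max 1 ((0 : ℝ) * ((phi0 (fun _ : Fin 0 => ([] : List ({x : Unit // (fun _ : Unit => ()) x ∈ ({()} : Finset Unit)} → ℝ)))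
            (fun _ : Unit => [(0 : {x : Unit // (fun _ : Unit => ()) x ∈ ({()} : Finset Unit)} → ℝ)]) 1 OX.1 + 0 : ℕ) : ℝ)))
          ^ phi0 (fun _ : Fin 0 => ([] : List ({x : Unit // (fun _ : Unit => ()) x ∈ ({()} : Finset Unit)} → ℝ)))
            (fun _ : Unit => [(0 : {x : Unit // (fun _ : Unit => ()) x ∈ ({()} : Finset Unit)} → ℝ)]) 1 OX.1
        * (max (1 : ℝ) (max ((1 : ℝ) ^ 1) 1)) ^ Multiset.card OX.2)
      (fun OX => ∏ _j ∈ OX.1, (1 : ℝ) ^ ([(0 : {x : Unit // (fun _ : Unit => ()) x ∈ ({()} : Finset Unit)} → ℝ)]).length)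
      (fun OX => nfreeOf (fun _ : Unit => (∅ : Finset Unit)) OX.2) 1 1 :=
  ineq312_remainder (β := Unit) toy_prec_posDef (Dir := {0}) (B' := fun _ => 0) (ρ := fun _ => 0) (cV := fun _ => 0)
    one_pos le_rfl le_rfl (fun _ => le_rfl) (fun _ => le_rfl) (fun m => m.elim0) zero_le_one le_rfl one_pos le_rfl
    one_pos le_rfl
    (fun _ u _ w _ => by simp) (fun _ u _ => by simp) (fun _ u _ => by simp)
    (fun m => m.elim0) (fun _ w hw => by simpa using hw) (fun m => m.elim0)
    (fun _ _ => ⟨zero_le_one, rfl⟩) (fun _ h => by simp at h) (fun m => m.elim0) le_rfl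
    (fun u _ => by simp) (fun _ u _ => by simp) zero_le_one (fun _ => zero_le_one)
    (toy_hE (fun _ => 0) (fun _ => false) 1)

end Toy

/-! ## §3 (v1.2, append-only)  A less degenerate toy: a genuine observable, the true covariance as the local piece -/

section Toy2

/-- **The expectation hypothesis on the second toy**: one site, the observable `Φ(e)` with the nonzero leg `e = 1`,
the true covariance `1 = prec⁻¹` as the single (local) piece, no vertex, `χ ≡ 1`; the moment letter is INSTANTIATED,
`Λ_O := Σ_{t ∈ expand 0 O} |𝔼[Π legs·(Π_{dirs t}∂)χ·e^{−V}]|`, so that every term obeys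
`|𝔼[…]| ≤ 1·Π_{z∈dirs t}(1·‖z‖)·Λ_O` (terms with a `χ′`-direction vanish, the others are summands of `Λ_O`).
[cite: BalabanImbrieJaffe1988, §5.14 p.312] -/
theorem toy2_hE (Cov : Unit → Matrix {x : Unit // (fun _ : Unit => ()) x ∈ ({()} : Finset Unit)}
      {x : Unit // (fun _ : Unit => ()) x ∈ ({()} : Finset Unit)} ℝ) (trig : Unit → Bool)
    (obs : Unit → List ({x : Unit // (fun _ : Unit => ()) x ∈ ({()} : Finset Unit)} → ℝ)) (M : ℕ) :
    ∀ O : Finset Unit, ∀ t ∈ expand Cov trig (src (fun _ : Unit => ()) (0 : Unit → ℝ) ({()} : Finset Unit))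
        (fun _ : Fin 0 => (0 : ℝ)) (fun _ : Fin 0 => ([] : List ({x : Unit // (fun _ : Unit => ()) x ∈ ({()} : Finset Unit)} → ℝ)))
        obs M 0 O, t.consts = 0 →
      |∫ φ, ((t.groups.map fun h => (h.pend : Multiset _)).sum.map fun w => φ ⬝ᵥ w).prod
          * (dlist t.dirs (fun _ => (1 : ℝ)) φ * vexp (fun _ : Fin 0 => (0 : ℝ)) (fun _ : Fin 0 => []) φ)
          ∂(fieldLaw (fun _ : Unit => ()) (1 : Matrix Unit Unit ℝ) (0 : Unit → ℝ) ({()} : Finset Unit))|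
        ≤ 1 * (t.dirs.map fun z => (1 : ℝ) * ‖z‖).prod
          * ((expand Cov trig (src (fun _ : Unit => ()) (0 : Unit → ℝ) ({()} : Finset Unit)) (fun _ : Fin 0 => (0 : ℝ))
              (fun _ : Fin 0 => ([] : List ({x : Unit // (fun _ : Unit => ()) x ∈ ({()} : Finset Unit)} → ℝ))) obs M 0 O).map
              fun t => |∫ φ, ((t.groups.map fun h => (h.pend : Multiset _)).sum.map fun w => φ ⬝ᵥ w).prod
                * (dlist t.dirs (fun _ => (1 : ℝ)) φ * vexp (fun _ : Fin 0 => (0 : ℝ)) (fun _ : Fin 0 => []) φ)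
                ∂(fieldLaw (fun _ : Unit => ()) (1 : Matrix Unit Unit ℝ) (0 : Unit → ℝ) ({()} : Finset Unit))|).sum := by
  intro O t ht _
  -- the instantiated moment letter dominates each of its (nonnegative) summands
  set Λ := ((expand Cov trig (src (fun _ : Unit => ()) (0 : Unit → ℝ) ({()} : Finset Unit)) (fun _ : Fin 0 => (0 : ℝ))
      (fun _ : Fin 0 => ([] : List ({x : Unit // (fun _ : Unit => ()) x ∈ ({()} : Finset Unit)} → ℝ))) obs M 0 O).map
      fun t => |∫ φ, ((t.groups.map fun h => (h.pend : Multiset _)).sum.map fun w => φ ⬝ᵥ w).prod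
        * (dlist t.dirs (fun _ => (1 : ℝ)) φ * vexp (fun _ : Fin 0 => (0 : ℝ)) (fun _ : Fin 0 => []) φ)
        ∂(fieldLaw (fun _ : Unit => ()) (1 : Matrix Unit Unit ℝ) (0 : Unit → ℝ) ({()} : Finset Unit))|).sum with hΛ
  have hΛ0 : 0 ≤ Λ := Multiset.sum_nonneg fun x hx => by
    obtain ⟨t', -, rfl⟩ := Multiset.mem_map.1 hx; exact abs_nonneg _
  have hle : |∫ φ, ((t.groups.map fun h => (h.pend : Multiset _)).sum.map fun w => φ ⬝ᵥ w).prod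
      * (dlist t.dirs (fun _ => (1 : ℝ)) φ * vexp (fun _ : Fin 0 => (0 : ℝ)) (fun _ : Fin 0 => []) φ)
      ∂(fieldLaw (fun _ : Unit => ()) (1 : Matrix Unit Unit ℝ) (0 : Unit → ℝ) ({()} : Finset Unit))| ≤ Λ :=
    Multiset.single_le_sum (fun x hx => by obtain ⟨t', -, rfl⟩ := Multiset.mem_map.1 hx; exact abs_nonneg _) _
      (Multiset.mem_map_of_mem _ ht)
  have hR : 0 ≤ 1 * (t.dirs.map fun z : {x : Unit // (fun _ : Unit => ()) x ∈ ({()} : Finset Unit)} → ℝ => (1 : ℝ) * ‖z‖).prod * Λ :=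
    mul_nonneg (mul_nonneg zero_le_one (List.prod_nonneg fun x hx => by
      obtain ⟨z, -, rfl⟩ := List.mem_map.1 hx; exact mul_nonneg zero_le_one (norm_nonneg z))) hΛ0
  rcases hD : t.dirs with _ | ⟨z, D⟩
  · -- no `χ′`-direction: the term is one of the summands of `Λ`
    rw [hD] at hle
    simpa only [List.map_nil, List.prod_nil, one_mul] using hle
  · -- a `χ′`-direction differentiates the constant cutoff away
    simp only [dlist_cons_const, Pi.zero_apply, zero_mul, mul_zero, integral_zero, abs_zero]
    exact hD ▸ hR

/-- **NON-VACUITY OF `ineq312_remainder_bdry` ON A LESS DEGENERATE TOY**: one site (`α = I = Unit`, `W = {()}`,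
`Δ = 1`, `ℱ = 0`), the genuine observable `Φ(e) = φ(site)` (`κ = Unit`, `obs () = [e]`, `e = 1`), no vertex, the
true covariance `Cov () = 1 = prec⁻¹` as the single LOCAL piece (`trig = false`, `reg = ∅`), `χ ≡ 1`, `Dir = {e}`,
`B′ = B_ℓ = #sites`, `ρ = ρ₀ = 1`, `θ = θ_v = θ_w = η_χ = K_χ = 1`, `N₀ = 0`, `M = 1`, `bdry = {()}` (the observable
is at the boundary), and the moment letter `Λ_O` instantiated as in `toy2_hE` — ALL HYPOTHESES DISCHARGED by the
kernel. [cite: BalabanImbrieJaffe1988, §5.14 p.312 (estimate preceding (5.14.5))] -/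
theorem ineq312_remainder_bdry_toy2 :
    BIJ88Sect5StatementsPart4.Ineq312 (remSys Unit Unit)
      (fun OX => remAt (prec (fun _ : Unit => ()) (1 : Matrix Unit Unit ℝ) ({()} : Finset Unit) (corner ℝ ({()} : Finset Unit)))
          (fun _ : Unit => (1 : Matrix {x : Unit // (fun _ : Unit => ()) x ∈ ({()} : Finset Unit)}
            {x : Unit // (fun _ : Unit => ()) x ∈ ({()} : Finset Unit)} ℝ)) (fun _ : Unit => false)
          (src (fun _ : Unit => ()) (0 : Unit → ℝ) ({()} : Finset Unit)) (fun _ : Fin 0 => (0 : ℝ)) (fun _ : Fin 0 => [])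
          (fun _ : Unit => [fun _ => (1 : ℝ)]) 1 (fun _ => (1 : ℝ)) (fun _ : Unit => (∅ : Finset Unit))
          (fun _ : Fin 0 => (∅ : Finset Unit)) (fun _ : Unit => (∅ : Finset Unit)) [] 0 OX.1 OX.2
        / ∫ φ, weight (prec (fun _ : Unit => ()) (1 : Matrix Unit Unit ℝ) ({()} : Finset Unit) (corner ℝ ({()} : Finset Unit))) φ
            * source (src (fun _ : Unit => ()) (0 : Unit → ℝ) ({()} : Finset Unit)) φ)
      (fun OX => (1 : ℝ)
        * (fun O : Finset Unit => ((expand (fun _ : Unit => (1 : Matrix {x : Unit // (fun _ : Unit => ()) x ∈ ({()} : Finset Unit)}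
              {x : Unit // (fun _ : Unit => ()) x ∈ ({()} : Finset Unit)} ℝ)) (fun _ : Unit => false)
              (src (fun _ : Unit => ()) (0 : Unit → ℝ) ({()} : Finset Unit)) (fun _ : Fin 0 => (0 : ℝ))
              (fun _ : Fin 0 => ([] : List ({x : Unit // (fun _ : Unit => ()) x ∈ ({()} : Finset Unit)} → ℝ)))
              (fun _ : Unit => [fun _ => (1 : ℝ)]) 1 0 O).map
              fun t => |∫ φ, ((t.groups.map fun h => (h.pend : Multiset _)).sum.map fun w => φ ⬝ᵥ w).prod
                * (dlist t.dirs (fun _ => (1 : ℝ)) φ * vexp (fun _ : Fin 0 => (0 : ℝ)) (fun _ : Fin 0 => []) φ)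
                ∂(fieldLaw (fun _ : Unit => ()) (1 : Matrix Unit Unit ℝ) (0 : Unit → ℝ) ({()} : Finset Unit))|).sum) OX.1
        * (max 1 ((1 : ℝ) * ((phi0 (fun _ : Fin 0 => ([] : List ({x : Unit // (fun _ : Unit => ()) x ∈ ({()} : Finset Unit)} → ℝ)))
            (fun _ : Unit => [fun _ => (1 : ℝ)]) 1 OX.1 + 0 : ℕ) : ℝ)))
          ^ phi0 (fun _ : Fin 0 => ([] : List ({x : Unit // (fun _ : Unit => ()) x ∈ ({()} : Finset Unit)} → ℝ)))
            (fun _ : Unit => [fun _ => (1 : ℝ)]) 1 OX.1)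
      (fun OX => ∏ _j ∈ OX.1.filter (fun j => j ∈ ({()} : Finset Unit)),
        ((Fintype.card {x : Unit // (fun _ : Unit => ()) x ∈ ({()} : Finset Unit)} : ℕ) : ℝ)
          ^ ([fun _ : {x : Unit // (fun _ : Unit => ()) x ∈ ({()} : Finset Unit)} => (1 : ℝ)]).length)
      (fun OX => nfreeOf (fun _ : Unit => (∅ : Finset Unit)) OX.2) 1 1 := by
  -- the sites: one of them, so `1 ≤ #sites`
  haveI : Nonempty {x : Unit // (fun _ : Unit => ()) x ∈ ({()} : Finset Unit)} := ⟨⟨(), by simp⟩⟩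
  have hcard : (1 : ℝ) ≤ ((Fintype.card {x : Unit // (fun _ : Unit => ()) x ∈ ({()} : Finset Unit)} : ℕ) : ℝ) :=
    Nat.one_le_cast.2 Fintype.card_pos
  have hsrc : src (fun _ : Unit => ()) (0 : Unit → ℝ) ({()} : Finset Unit) = 0 := by funext x; simp [src]
  -- the leg `e = 1`: `1·e = e`, `⟨e,e⟩ = #sites`, `‖e‖ = 1`
  have he : ‖(fun _ : {x : Unit // (fun _ : Unit => ()) x ∈ ({()} : Finset Unit)} => (1 : ℝ))‖ = 1 := by
    rw [pi_norm_const, norm_one]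
  have hee : (fun _ : {x : Unit // (fun _ : Unit => ()) x ∈ ({()} : Finset Unit)} => (1 : ℝ))
      ⬝ᵥ (fun _ => (1 : ℝ)) = ((Fintype.card {x : Unit // (fun _ : Unit => ()) x ∈ ({()} : Finset Unit)} : ℕ) : ℝ) := by
    simp [dotProduct]
  refine ineq312_remainder_bdry (β := Unit) toy_prec_posDef (Dir := {fun _ => (1 : ℝ)})
    (B' := fun _ => ((Fintype.card {x : Unit // (fun _ : Unit => ()) x ∈ ({()} : Finset Unit)} : ℕ) : ℝ))
    (ρ := fun _ => 1) (cV := fun _ => 0)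
    one_pos le_rfl hcard (fun _ => zero_le_one.trans hcard) (fun _ => zero_le_one) (fun m => m.elim0) zero_le_one le_rfl
    one_pos le_rfl one_pos le_rfl ?_ ?_ ?_ (fun m => m.elim0) (fun _ w hw => by simpa using hw) (fun m => m.elim0)
    (fun _ _ => ⟨le_rfl, rfl⟩) (fun _ h => by simp at h) (fun m => m.elim0) zero_le_one ?_ (fun _ u _ => by simp) zero_le_one
    (fun O => Multiset.sum_nonneg fun x hx => by obtain ⟨t', -, rfl⟩ := Multiset.mem_map.1 hx; exact abs_nonneg _)
    (toy2_hE _ _ _ 1) ({()} : Finset Unit) (fun O t _ _ X _ => by simp)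
  · -- hB
    intro p u hu w hw
    rw [Set.mem_singleton_iff] at hu hw
    subst hu; subst hw
    rw [Matrix.one_mulVec, hee, mul_one, abs_of_nonneg (zero_le_one.trans hcard)]
  · -- hBf
    intro p u _
    rw [hsrc, dotProduct_zero, abs_zero, mul_one]
    exact zero_le_one.trans hcard
  · -- hBz
    intro p u hu
    rw [Set.mem_singleton_iff] at hu
    subst hu
    rw [Matrix.one_mulVec, he, mul_one]
    exact hcard
  · -- hρ₀ : one piece
    intro u _
    calc (∑ p ∈ univ.filter (fun p : Unit => (1 : Matrix {x : Unit // (fun _ : Unit => ()) x ∈ ({()} : Finset Unit)}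
            {x : Unit // (fun _ : Unit => ()) x ∈ ({()} : Finset Unit)} ℝ) *ᵥ u ≠ 0), (1 : ℝ))
        ≤ ∑ _p ∈ (univ : Finset Unit), (1 : ℝ) :=
          Finset.sum_le_sum_of_subset_of_nonneg (Finset.filter_subset _ _) fun _ _ _ => zero_le_one
      _ = 1 := by simp

end Toy2

end Literature.MathematicalPhysics.QuantumFieldTheory.BalabanImbrieJaffe1984to88.BIJ88WalkIneq312NonVacuity

end
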